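import Literature.MathematicalPhysics.QuantumFieldTheory.Balaban1983to89.Node00.AveragingTwoBlockWindow
import Literature.MathematicalPhysics.QuantumFieldTheory.Balaban1983to89.Node00.TkFirstStepRegionVanishing

/-!
# NODE 00 — THE AVERAGING OF RECORD IS A SKEW PRODUCT OVER THE BOND PARTITION OF A SATURATED REGION: presentations of both
# carriers by `piEquivPiSubtypeProd`, the out-factor = 11a's `avgRestrOfRecord` literally, the skew intertwining, and BOTH
# absolute-continuity binders of the skew chain rule for the tree's `kernelTransport` DISCHARGED at the record

Cell `pub-ymgap`, YM-PLAN Track A (D-0062), seat `pub-ymgap-dag-n11-e` (g21; R134 N11 [B14] s3; count-neutral; `--supports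
stmt-QuantumFields-20542`).  NEW leaf over landed files, CONSUMED BY NAME and not modified: g20's `Node00.AveragingTwoBlockWindow`
(★ `avgRestrOfRecord_apply_eq_avOfRecord_of_eqOn`: on its image bonds 11a's restricted averaging is the true average), def-T's 11a
`Node00.TkOfRecord` (`avgRestrOfRecord`, `kernelRT`, `kernelRTOfRecord`) and `Node00.TkFirstStepRegionVanishing` (`measurable_avgRestrOfRecord`),
pub-balaban's `BlockAveragingHaarAC` (`centralBond`, `centralBond_injective`, `isLocal_avgFun`), `BlockAveragingEMLHaarAC` ∕ `…EMLHaarACSUN` ∕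
`…EMLFibreLawSUN` (the one-variable laws of (0.4) on `SU(N)` are absolutely continuous: `emlFibreLaw_fin`), `T4TriangularPushforward` (the
triangular push-forward theorem, resampling), `AveragingRT` (`lineSite_eq_lo ∕ _hi`), and Mathlib's `MeasurableEquiv.piEquivPiSubtypeProd` ∕
`MeasureTheory.measurePreserving_piEquivPiSubtypeProd`.

WHY (pub-ymgap INBOX 2026-08-28: dag-n11-w2 g3 CLAIM-2 l.30598 «the presentations themselves at the record …, `avOfRecord`'s skew shape =
n11-e's `AveragingTwoBlockWindow`»; dag-n11-d g14 INTENT-3′ l.30612).  The skew-product chain rule for def-T's `kernelTransport`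
(`Summits/…/BalabanUVNodesN11KernelTransportSkewProduct` §4, and its re-coordinatised form) separates the one-step transport `(†)` of
[Balaban1988Convergent] (3.1) p. 264 into the OUTER conditional `V`-integrations KEPT by the operation `𝐓^{(k)}` of (2.21) p. 258 («`∫dV_k|_{Ω^c_{k+1} ∩ X}
δ(V̄_kV_{k+1}⁻¹)`», 11a's `kernelRTOfRecord`) and the INNER, charted transport over `Ω_{k+1}` (p. 267 «we remove the δ-functions using the operator C»),
GIVEN: presentations `ν = (ν_out ⊗ ν_in).map e_β`, `μ = (μ_out ⊗ μ_r).map e_α` of the two product Haar measures, the SKEW INTERTWINING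
`avg (e_β U) = e_α (avg_out U.1, avg_rest U)`, and the two absolute-continuity binders `hac_out : ν_out.map avg_out ≪ μ_out`,
`hac_in : (ν_out ⊗ ν_in).map (U ↦ (U.1, avg_rest U)) ≪ ν_out ⊗ μ_r`.  This file supplies ALL FIVE at the record, for the bond partition
`sV ∕ sVᶜ` (level `j`) and `sV' ∕ sV'ᶜ` (level `j+1`) of a fine region `Y` saturated at level `j+1` (g20's `hY`; both `IsBlockUnion` currencies give it,
`AveragingTwoBlockWindow` §3) with `bondsIn j Y` between `sV` and `sV'` as each statement needs (11a's `genDataOfRecord` choice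
`sV = bondsIn j (Ω_{j+1})ᶜ`, `sV' = bondsIn (j+1) (Ω_{j+1})ᶜ` satisfies all of them, §3), with `e_β`, `e_α` Mathlib's `piEquivPiSubtypeProd` glue and
`avg_out = avgRestrOfRecord F N K j sV sV'` LITERALLY — so the out-factor transport is 11a's `kernelRTOfRecord` by `rfl` (§2
`kernelTransport_avgRestrOfRecord_eq_kernelRTOfRecord`): no swap face is needed on the out side of the «11a bridge».

CONTENTS (theorems only; 0 `def`).
§0 two generic tools (PRIVATE plumbing, [folklore]) — `map_prod_pi_absolutelyContinuous_param` (PARAMETRIC MIXTURE ENGINE: `(e, g) ↦ (π e, c ↦ f c e (g c))` pushes `ν ⊗ μ^κ` to a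
   measure `≪ (π_*ν) ⊗ μ^κ` when the one-variable laws `μ.map (f c e)` are a.c. for `ν`-a.e. `e`; the constant-`π` case is
   `T4TriangularPushforward.map_prod_pi_absolutelyContinuous`) · `updateFinset_update`.
§1 generic lattice `P`, any gauge group — `measurePreserving_piEquivPiSubtypeProd_fieldMeasure` (+ `_symm_`), ★ `fieldMeasure_eq_map_piEquivPiSubtypeProd_symm`
   (`dU = ((Π_{s} dU(b)) ⊗ (Π_{sᶜ} dU(b))).map glue`, ANY finset at ANY level — so both carriers); the glue read bondwise (private: `_apply_of_mem ∕
   _of_not_mem`, `_update_fst ∕ _update_snd`, `_extend` = resampling through the glue; public: `_one_eq_updateFinset` = 11a's extension by `1`); geometry of the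
   private coordinate: `blockOf_centralBond_src ∕ _tgt` (the central crossing bond `β(c)` joins `B(c₋)` to `B(c₊)`), ★ `centralBond_mem_bondsIn_iff`
   (`β(c) ∈ bondsIn j Y ↔ c ∈ bondsIn (j+1) Y` under saturation).
§2 of record, `G = SU(N)` — ★ `avOfRecord_glue_apply_of_mem` (THE OUT-FACTOR IS `avgRestrOfRecord`), `kernelTransport_avgRestrOfRecord_eq_kernelRTOfRecord`
   (`rfl`), ★★ `avOfRecord_glue_eq_glue` (THE SKEW INTERTWINING) + its forward reading `piEquivPiSubtypeProd_avOfRecord_glue`, measurability of the rest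
   factor and of the skew map, `map_haar_avOfRecord_update_centralBond_absolutelyContinuous` (one-variable laws a.c., every `N ≥ 1`),
   ★★ `map_pi_avgRestrOfRecord_absolutelyContinuous` (= `hac_out`: 11a's restricted averaging pushes product Haar to an a.c. law — triangular
   push-forward in the private coordinates `β(c') ∈ sV`), ★★ `map_prod_avOfRecord_glue_skew_absolutelyContinuous` (= `hac_in`: the skew map
   `(y, r) ↦ (y, avg_rest (y, r))` pushes product Haar to an a.c. law — resampling of the private coordinates `β(c) ∉ sV` of the off-`sV` part +
   locality + §0).
§3 at the bond sets OF RECORD `sV := (bondsIn j Y).toFinset`, `sV' := (bondsIn (j+1) Y).toFinset` (11a's `genDataOfRecord` at `Y = (Ω_{j+1})ᶜ`):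
   the intertwining and both a.c. faces with every inclusion discharged.

HONEST FRAMING.  [folklore] measure theory (push-forward, product measures, Fubini, resampling) and lattice bookkeeping over landed
definitions; the cites are LOCATORS of the averaging ∕ the 𝐓-operation, not claims; the saturation of def-R's regions is DISPLAYED (`hY`);
no chart, no Jacobian, no estimate of Bałaban ([I] §2, [III] §3 (3.10)–(3.25), [15] (47)) is asserted; the separated-transport identity itself
is the consumers' (n11-w2 ∕ n11-d) composition, not proved here; (B4)∕(S-α) NOT closed; N11 NOT discharged; K1⁷ NOT closed; counts unmoved
(typed 28∕28 · discharged 5∕27).  One finite `𝕋⁴` programme at fixed `ε`; R4 = the conditional finite-𝕋⁴ rung only — NOT ℝ⁴ ∕ OS ∕ mass gap ∕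
Clay.  No `sorry`, no `axiom`, no `def`, no `instance`, no `notation`.
-/

noncomputable section

namespace Literature.MathematicalPhysics.QuantumFieldTheory.Balaban1983to89.Node00

open _root_.MeasureTheory _root_.Function _root_.Set
open scoped ENNReal
open T4Continuum BlockAveraging AveragingRT BlockAveragingHaarAC T4AveragingDisintegration ExpMeanLog
open B10Eq42TorusConstraint (bondsIn mem_bondsIn_iff)
open B10Eq38TorusDomains (toFine)

/-! ## §0  Two generic tools: a parametric mixture engine and `updateFinset` through an `update` -/

section Mixture

variable {E E' κ G : Type*} [MeasurableSpace E] [MeasurableSpace E'] [MeasurableSpace G]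

/-- **PARAMETRIC MIXTURE ENGINE** (the environment is partly KEPT as an output).  Let `ν` be an s-finite law of an environment
`e : E`, `π : E → E'` a measurable reading of it, `μ` a finite measure on `G`, and `f c : E → G → G` (`c : κ`, finite) jointly
measurable one-variable maps whose laws `μ.map (f c e)` are absolutely continuous for `ν`-a.e. `e` and every `c`.  Then
`(e, g) ↦ (π e, c ↦ f c e (g c))` pushes `ν ⊗ μ^κ` to a measure absolutely continuous with respect to `(π_* ν) ⊗ μ^κ`:
conditionally on `e` the second output is a product of independent absolutely continuous coordinates (`Measure.pi_map_pi`,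
`T4TriangularPushforward.pi_absolutelyContinuous_pi`), and a null set of the target has `μ^κ`-null fibres over `π_* ν`-a.e. point
(`Measure.prod_apply`).  `T4TriangularPushforward.map_prod_pi_absolutelyContinuous` is the case of a constant `π`. [folklore] -/
private theorem map_prod_pi_absolutelyContinuous_param [Fintype κ] (ν : Measure E) [SFinite ν] (μ : Measure G) [IsFiniteMeasure μ]
    {π : E → E'} (hπ : Measurable π) (f : κ → E → G → G) (hf : ∀ c, Measurable (uncurry (f c)))
    (hac : ∀ᵐ e ∂ν, ∀ c, μ.map (f c e) ≪ μ) :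
    (ν.prod (Measure.pi fun _ : κ => μ)).map (fun p : E × (κ → G) => (π p.1, fun c => f c p.1 (p.2 c))) ≪
      (ν.map π).prod (Measure.pi fun _ : κ => μ) := by
  have hΦ₂ : Measurable (fun p : E × (κ → G) => fun c => f c p.1 (p.2 c)) :=
    measurable_pi_lambda _ fun c =>
      (hf c).comp (measurable_fst.prodMk ((measurable_pi_apply c).comp measurable_snd))
  have hΦ : Measurable (fun p : E × (κ → G) => (π p.1, fun c => f c p.1 (p.2 c))) :=
    (hπ.comp measurable_fst).prodMk hΦ₂
  refine Measure.AbsolutelyContinuous.mk fun s hs hs0 => ?_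
  rw [Measure.map_apply hΦ hs, Measure.prod_apply (hΦ hs)]
  rw [Measure.prod_apply hs] at hs0
  have h0 : ∀ᵐ e' ∂(ν.map π), (Measure.pi fun _ : κ => μ) (Prod.mk e' ⁻¹' s) = 0 :=
    (lintegral_eq_zero_iff (measurable_measure_prodMk_left hs)).1 hs0
  have h0' : ∀ᵐ e ∂ν, (Measure.pi fun _ : κ => μ) (Prod.mk (π e) ⁻¹' s) = 0 := ae_of_ae_map hπ.aemeasurable h0
  refine (lintegral_congr_ae ((hac.and h0').mono fun e he => ?_)).trans lintegral_zero
  obtain ⟨he, he0⟩ := he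
  have hfe : ∀ c, Measurable (f c e) := fun c => (hf c).comp (measurable_const.prodMk measurable_id)
  have hΦe : Measurable (fun g : κ → G => fun c => f c e (g c)) :=
    measurable_pi_lambda _ fun c => (hfe c).comp (measurable_pi_apply c)
  show (Measure.pi fun _ : κ => μ)
      (Prod.mk e ⁻¹' ((fun p : E × (κ → G) => (π p.1, fun c => f c p.1 (p.2 c))) ⁻¹' s)) = 0
  have h1 : Prod.mk e ⁻¹' ((fun p : E × (κ → G) => (π p.1, fun c => f c p.1 (p.2 c))) ⁻¹' s) =
      (fun g : κ → G => fun c => f c e (g c)) ⁻¹' (Prod.mk (π e) ⁻¹' s) := rfl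
  rw [h1, ← Measure.map_apply hΦe (measurable_prodMk_left hs), Measure.pi_map_pi (fun c => (hfe c).aemeasurable)]
  exact T4TriangularPushforward.pi_absolutelyContinuous_pi he he0

end Mixture

section UpdateFinset

variable {ι α : Type*} [DecidableEq ι]

/-- Updating one coordinate of the `s`-datum and then writing it into `f` = writing the datum and then updating that coordinate.
[folklore] -/
private theorem updateFinset_update (f : ι → α) (s : Finset ι) (y : ↥s → α) (b : ↥s) (g : α) :
    updateFinset f s (update y b g) = update (updateFinset f s y) b g := by
  funext i
  rw [updateFinset_def, updateFinset_def]
  by_cases hib : i = (b : ι)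
  · subst hib
    simp only [update_self, dif_pos b.2, Subtype.coe_eta]
  · rw [update_of_ne hib]
    by_cases hi : i ∈ s
    · simp only [dif_pos hi]
      rw [update_of_ne (fun h => hib (congrArg Subtype.val h))]
    · simp only [dif_neg hi]

end UpdateFinset

/-! ## §1  Generic lattice: the bond partition of a finset presents the product Haar measure; the glue read bondwise;
the central crossing bond of a coarse bond joins its two blocks -/

section Generic

variable {P : Params} {j : ℕ} {G : Type*} [GaugeGroup G] [MeasurableSpace G] [HaarData G]

/-- **THE FINE∕COARSE CARRIER PRESENTED BY A BOND PARTITION**: for every finset `s` of level-`j` bonds, Mathlib's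
`MeasurableEquiv.piEquivPiSubtypeProd` at the predicate `(· ∈ s)` carries the product Haar measure `dU = Π_b dU(b)` to the product
of the product Haar measures on the `s`-bonds and on the other bonds (`MeasureTheory.measurePreserving_piEquivPiSubtypeProd`).
[cite: Balaban1985Averaging, (10) p.19 (bookkeeping)] -/
theorem measurePreserving_piEquivPiSubtypeProd_fieldMeasure [DecidableEq (PBond P j)] (s : Finset (PBond P j)) :
    MeasurePreserving (MeasurableEquiv.piEquivPiSubtypeProd (fun _ : PBond P j => G) (· ∈ s)) (fieldMeasure P j G)
      ((Measure.pi fun _ : ↥s => (HaarData.haar : Measure G)).prod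
        (Measure.pi fun _ : {b : PBond P j // b ∉ s} => (HaarData.haar : Measure G))) := by
  unfold fieldMeasure
  -- Mathlib states it with the `Subtype.fintype` instance on `{b // b ∈ s}`; align it with the finset's instance
  have h := measurePreserving_piEquivPiSubtypeProd (fun _ : PBond P j => (HaarData.haar : Measure G)) (· ∈ s)
  have hinst : (Subtype.fintype fun b => b ∈ s) = Finset.Subtype.fintype s := Subsingleton.elim _ _
  rw [hinst] at h
  exact h

/-- The glue `(y, r) ↦ U` (the inverse equivalence) is measure preserving in the other direction. [cite: Balaban1985Averaging, (10) p.19 (bookkeeping)] -/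
theorem measurePreserving_piEquivPiSubtypeProd_symm_fieldMeasure [DecidableEq (PBond P j)] (s : Finset (PBond P j)) :
    MeasurePreserving (MeasurableEquiv.piEquivPiSubtypeProd (fun _ : PBond P j => G) (· ∈ s)).symm
      ((Measure.pi fun _ : ↥s => (HaarData.haar : Measure G)).prod
        (Measure.pi fun _ : {b : PBond P j // b ∉ s} => (HaarData.haar : Measure G))) (fieldMeasure P j G) :=
  (measurePreserving_piEquivPiSubtypeProd_fieldMeasure s).symm _

/-- **`dU` IS THE GLUED PRODUCT**: `fieldMeasure P j G = ((Π_{b ∈ s} dU(b)) ⊗ (Π_{b ∉ s} dU(b))).map glue` — the shape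
`ν = (ν_out.prod ν_in).map e_β` of the skew-product chain rule for the tree's `kernelTransport`. [cite: Balaban1985Averaging, (10) p.19 (bookkeeping)] -/
theorem fieldMeasure_eq_map_piEquivPiSubtypeProd_symm [DecidableEq (PBond P j)] (s : Finset (PBond P j)) :
    fieldMeasure P j G =
      ((Measure.pi fun _ : ↥s => (HaarData.haar : Measure G)).prod
        (Measure.pi fun _ : {b : PBond P j // b ∉ s} => (HaarData.haar : Measure G))).map
        ⇑(MeasurableEquiv.piEquivPiSubtypeProd (fun _ : PBond P j => G) (· ∈ s)).symm :=
  (measurePreserving_piEquivPiSubtypeProd_symm_fieldMeasure s).map_eq.symm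

omit [GaugeGroup G] [MeasurableSpace G] [HaarData G] in
/-- The glue reads the first component on the bonds of `s`. [folklore] -/
private theorem piEquivPiSubtypeProd_symm_apply_of_mem [MeasurableSpace G] [DecidableEq (PBond P j)] (s : Finset (PBond P j))
    (q : (↥s → G) × ({b : PBond P j // b ∉ s} → G)) {b : PBond P j} (hb : b ∈ s) :
    (MeasurableEquiv.piEquivPiSubtypeProd (fun _ : PBond P j => G) (· ∈ s)).symm q b = q.1 ⟨b, hb⟩ := by
  show (if h : b ∈ s then q.1 ⟨b, h⟩ else q.2 ⟨b, h⟩) = q.1 ⟨b, hb⟩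
  rw [dif_pos hb]

omit [GaugeGroup G] [MeasurableSpace G] [HaarData G] in
/-- The glue reads the second component off `s`. [folklore] -/
private theorem piEquivPiSubtypeProd_symm_apply_of_not_mem [MeasurableSpace G] [DecidableEq (PBond P j)] (s : Finset (PBond P j))
    (q : (↥s → G) × ({b : PBond P j // b ∉ s} → G)) {b : PBond P j} (hb : b ∉ s) :
    (MeasurableEquiv.piEquivPiSubtypeProd (fun _ : PBond P j => G) (· ∈ s)).symm q b = q.2 ⟨b, hb⟩ := by
  show (if h : b ∈ s then q.1 ⟨b, h⟩ else q.2 ⟨b, h⟩) = q.2 ⟨b, hb⟩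
  rw [dif_neg hb]

omit [GaugeGroup G] [MeasurableSpace G] [HaarData G] in
/-- The glue of `(y, 1)` is 11a's «field extended by `1` off `s`» `Function.updateFinset 1 s y`. [cite: Balaban1988Convergent, (2.21) p.258 (bookkeeping)] -/
theorem piEquivPiSubtypeProd_symm_one_eq_updateFinset [MeasurableSpace G] [One G] [DecidableEq (PBond P j)]
    (s : Finset (PBond P j)) (y : ↥s → G) :
    (MeasurableEquiv.piEquivPiSubtypeProd (fun _ : PBond P j => G) (· ∈ s)).symm (y, fun _ => 1) =
      updateFinset (fun _ => (1 : G)) s y := by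
  funext b
  rw [updateFinset_def]
  rfl

omit [GaugeGroup G] [MeasurableSpace G] [HaarData G] in
/-- Updating an `s`-coordinate of the datum updates that bond of the glued field. [folklore] -/
private theorem piEquivPiSubtypeProd_symm_update_fst [MeasurableSpace G] [DecidableEq (PBond P j)] (s : Finset (PBond P j))
    (y : ↥s → G) (r : {b : PBond P j // b ∉ s} → G) (b : ↥s) (g : G) :
    (MeasurableEquiv.piEquivPiSubtypeProd (fun _ : PBond P j => G) (· ∈ s)).symm (update y b g, r) =
      update ((MeasurableEquiv.piEquivPiSubtypeProd (fun _ : PBond P j => G) (· ∈ s)).symm (y, r)) b g := by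
  funext i
  by_cases hib : i = (b : PBond P j)
  · subst hib
    rw [update_self, piEquivPiSubtypeProd_symm_apply_of_mem s _ b.2]
    simp only [Subtype.coe_eta, update_self]
  · rw [update_of_ne hib]
    by_cases hi : i ∈ s
    · have hne : (⟨i, hi⟩ : ↥s) ≠ b := fun h => hib (congrArg Subtype.val h)
      rw [piEquivPiSubtypeProd_symm_apply_of_mem s _ hi, piEquivPiSubtypeProd_symm_apply_of_mem s _ hi]
      exact update_of_ne hne _ _
    · rw [piEquivPiSubtypeProd_symm_apply_of_not_mem s _ hi, piEquivPiSubtypeProd_symm_apply_of_not_mem s _ hi]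

omit [GaugeGroup G] [MeasurableSpace G] [HaarData G] in
/-- Updating an off-`s` coordinate of the datum updates that bond of the glued field. [folklore] -/
private theorem piEquivPiSubtypeProd_symm_update_snd [MeasurableSpace G] [DecidableEq (PBond P j)] (s : Finset (PBond P j))
    (y : ↥s → G) (r : {b : PBond P j // b ∉ s} → G) (b : {b : PBond P j // b ∉ s}) (g : G) :
    (MeasurableEquiv.piEquivPiSubtypeProd (fun _ : PBond P j => G) (· ∈ s)).symm (y, update r b g) =
      update ((MeasurableEquiv.piEquivPiSubtypeProd (fun _ : PBond P j => G) (· ∈ s)).symm (y, r)) b g := by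
  funext i
  by_cases hib : i = (b : PBond P j)
  · subst hib
    rw [update_self, piEquivPiSubtypeProd_symm_apply_of_not_mem s _ b.2]
    simp only [Subtype.coe_eta, update_self]
  · rw [update_of_ne hib]
    by_cases hi : i ∈ s
    · rw [piEquivPiSubtypeProd_symm_apply_of_mem s _ hi, piEquivPiSubtypeProd_symm_apply_of_mem s _ hi]
    · have hne : (⟨i, hi⟩ : {b : PBond P j // b ∉ s}) ≠ b := fun h => hib (congrArg Subtype.val h)
      rw [piEquivPiSubtypeProd_symm_apply_of_not_mem s _ hi, piEquivPiSubtypeProd_symm_apply_of_not_mem s _ hi]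
      exact update_of_ne hne _ _

omit [GaugeGroup G] [MeasurableSpace G] [HaarData G] in
/-- RESAMPLING THROUGH THE GLUE: replacing the off-`s` coordinates `β c` of the datum by fresh values `g c` and gluing = gluing and
then resampling the field at the bonds `↑(β c)` (`Function.extend` on both sides; `β` injective). [folklore] -/
private theorem piEquivPiSubtypeProd_symm_extend [MeasurableSpace G] [DecidableEq (PBond P j)] (s : Finset (PBond P j))
    {κ : Type*} {β : κ → {b : PBond P j // b ∉ s}} (hβ : Injective β)
    (y : ↥s → G) (r : {b : PBond P j // b ∉ s} → G) (g : κ → G) :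
    (MeasurableEquiv.piEquivPiSubtypeProd (fun _ : PBond P j => G) (· ∈ s)).symm (y, extend β g r) =
      extend (fun c => (β c : PBond P j)) g
        ((MeasurableEquiv.piEquivPiSubtypeProd (fun _ : PBond P j => G) (· ∈ s)).symm (y, r)) := by
  have hβ' : Injective (fun c => (β c : PBond P j)) := fun c c' h => hβ (Subtype.ext h)
  funext i
  by_cases hex : ∃ c, (β c : PBond P j) = i
  · obtain ⟨c, rfl⟩ := hex
    rw [hβ'.extend_apply, piEquivPiSubtypeProd_symm_apply_of_not_mem s _ (β c).2]
    simp only [Subtype.coe_eta]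
    rw [hβ.extend_apply]
  · rw [extend_apply' _ _ _ hex]
    by_cases hi : i ∈ s
    · rw [piEquivPiSubtypeProd_symm_apply_of_mem s _ hi, piEquivPiSubtypeProd_symm_apply_of_mem s _ hi]
    · rw [piEquivPiSubtypeProd_symm_apply_of_not_mem s _ hi, piEquivPiSubtypeProd_symm_apply_of_not_mem s _ hi]
      refine extend_apply' _ _ _ ?_
      rintro ⟨c, hc⟩
      exact hex ⟨c, congrArg Subtype.val hc⟩

omit [MeasurableSpace G] [HaarData G] in
/-- The source of the central crossing bond `β(c)` lies in the block `B(c₋)` (standing range). [cite: Balaban1984PropagatorsI, (1.7) p.18 (bookkeeping)] -/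
theorem blockOf_centralBond_src (hj : j + 1 ≤ P.m + P.K) (c : PBond P (j + 1)) : blockOf (centralBond c).src = c.src := by
  show blockOf (lineSite c ((P.L - 1) / 2)) = c.src
  rw [lineSite_eq_lo hj c le_rfl, Site.blockOf_blockSite hj]

omit [MeasurableSpace G] [HaarData G] in
/-- The target of the central crossing bond `β(c)` lies in the block `B(c₊)` (standing range): `β(c)` CROSSES from `B(c₋)` to `B(c₊)`.
[cite: Balaban1984PropagatorsI, (1.7) p.18 (bookkeeping)] -/
theorem blockOf_centralBond_tgt (hj : j + 1 ≤ P.m + P.K) (c : PBond P (j + 1)) : blockOf (centralBond c).tgt = c.tgt := by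
  show blockOf ((lineSite c ((P.L - 1) / 2)).shift c.dir) = c.tgt
  have hL := P.L_pos
  rw [← lineSite_succ, lineSite_eq_hi hj c (t := (P.L - 1) / 2 + 1) (by omega) (by omega), Site.blockOf_blockSite hj]

omit [MeasurableSpace G] [HaarData G] in
/-- **WHERE THE PRIVATE COORDINATE LIVES**: for a fine region `Y` saturated at level `j+1`, the central crossing bond `β(c)` is a bond
of `Y` iff the coarse bond `c` is: `β(c) ∈ bondsIn j Y ↔ c ∈ bondsIn (j+1) Y`. [cite: Balaban1987RG1, (0.4) p.253 (bookkeeping)] -/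
theorem centralBond_mem_bondsIn_iff (hj : j + 1 ≤ P.m + P.K) {Y : Set (Site P 0)}
    (hY : ∀ s : Site P j, toFine j s ∈ Y ↔ toFine (j + 1) (blockOf s) ∈ Y) (c : PBond P (j + 1)) :
    centralBond c ∈ bondsIn j Y ↔ c ∈ bondsIn (j + 1) Y := by
  rw [mem_bondsIn_iff, mem_bondsIn_iff, hY, hY, show (centralBond c).src.shift (centralBond c).dir = (centralBond c).tgt from rfl,
    blockOf_centralBond_src hj, blockOf_centralBond_tgt hj]
  rfl

end Generic

/-! ## §2  Of record (`G = SU(N)`): the skew factors of the averaging of record over the bond partition of a saturated region -/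

section OfRecord

variable (F : T4Family) (N : ℕ) [NeZero N]

/-- **★ THE OUT-FACTOR IS 11a's RESTRICTED AVERAGING, LITERALLY.**  For a fine region `Y` saturated at level `j+1`, finsets
`sV ⊇ bondsIn j Y`, `sV' ⊆ bondsIn (j+1) Y`, every datum `q = (y, r)` (on `sV` ∕ off `sV`) and every `c ∈ sV'`: the average of record
of the glued field at `c` is `avgRestrOfRecord F N K j sV sV' y c` — it does not read `r` (two-block window, p610277 ★).  Hence the
out-factor transport `kernelTransport (Π_{sV} Haar) (Π_{sV'} Haar) avg_out` of the skew chain rule is 11a's `kernelRTOfRecord F N K j sV sV'`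
by `rfl`. [cite: Balaban1988Convergent, (2.21) p.258, (3.1) p.264 (bookkeeping)] -/
theorem avOfRecord_glue_apply_of_mem (K j : ℕ) [DecidableEq (PBond (F.P K) j)] (hj : j + 1 ≤ (F.P K).m + (F.P K).K)
    {Y : Set (Site (F.P K) 0)} (hY : ∀ s : Site (F.P K) j, toFine j s ∈ Y ↔ toFine (j + 1) (blockOf s) ∈ Y)
    {sV : Finset (PBond (F.P K) j)} (hsV : ∀ b : PBond (F.P K) j, b ∈ bondsIn j Y → b ∈ sV)
    {sV' : Finset (PBond (F.P K) (j + 1))} (hsV' : ∀ c : PBond (F.P K) (j + 1), c ∈ sV' → c ∈ bondsIn (j + 1) Y)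
    (q : (↥sV → SU N) × ({b : PBond (F.P K) j // b ∉ sV} → SU N)) (c : ↥sV') :
    (avOfRecord F N K j).avg ((MeasurableEquiv.piEquivPiSubtypeProd (fun _ : PBond (F.P K) j => SU N) (· ∈ sV)).symm q) c =
      avgRestrOfRecord F N K j sV sV' q.1 c :=
  (avgRestrOfRecord_apply_eq_avOfRecord_of_eqOn F N K j hj hY hsV hsV' q.1 _
    (fun b => piEquivPiSubtypeProd_symm_apply_of_mem sV q b.2) c).symm

/-- **THE OUT-FACTOR TRANSPORT IS 11a's `kernelRTOfRecord`** (`rfl`, recorded for the consumers of the skew chain rule: its out-factor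
`kernelTransport (Π_{sV} Haar) (Π_{sV'} Haar) avg_out` with `avg_out := avgRestrOfRecord F N K j sV sV'` is by definition 11a's restricted transport
of record). [cite: Balaban1988Convergent, (2.21) p.258 (bookkeeping)] -/
theorem kernelTransport_avgRestrOfRecord_eq_kernelRTOfRecord (K j : ℕ) [DecidableEq (PBond (F.P K) j)]
    (sV : Finset (PBond (F.P K) j)) (sV' : Finset (PBond (F.P K) (j + 1))) :
    kernelTransport (Measure.pi fun _ : ↥sV => (HaarData.haar : Measure (SU N)))
        (Measure.pi fun _ : ↥sV' => (HaarData.haar : Measure (SU N))) (avgRestrOfRecord F N K j sV sV') =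
      kernelRTOfRecord F N K j sV sV' := rfl

/-- **★★ THE SKEW INTERTWINING** (the displayed hypothesis `avg (e_β U) = e_α (avg_out U.1, avg_rest U)` of the skew chain rule for the tree's
`kernelTransport`, AT THE RECORD): gluing a datum and averaging = gluing (at the coarse finset `sV'`) the restricted averaging of the `sV`-part
with the remaining coarse bond variables of the averaged glued field.  The out-factor `avg_out := avgRestrOfRecord F N K j sV sV'` reads the
`sV`-part only; the rest factor `avg_rest q := (c ↦ avg (glue q) c)` may read everything. [cite: Balaban1988Convergent, (2.21) p.258, (3.1) p.264 (bookkeeping)] -/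
theorem avOfRecord_glue_eq_glue (K j : ℕ) [DecidableEq (PBond (F.P K) j)] [DecidableEq (PBond (F.P K) (j + 1))]
    (hj : j + 1 ≤ (F.P K).m + (F.P K).K)
    {Y : Set (Site (F.P K) 0)} (hY : ∀ s : Site (F.P K) j, toFine j s ∈ Y ↔ toFine (j + 1) (blockOf s) ∈ Y)
    {sV : Finset (PBond (F.P K) j)} (hsV : ∀ b : PBond (F.P K) j, b ∈ bondsIn j Y → b ∈ sV)
    {sV' : Finset (PBond (F.P K) (j + 1))} (hsV' : ∀ c : PBond (F.P K) (j + 1), c ∈ sV' → c ∈ bondsIn (j + 1) Y)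
    (q : (↥sV → SU N) × ({b : PBond (F.P K) j // b ∉ sV} → SU N)) :
    (avOfRecord F N K j).avg ((MeasurableEquiv.piEquivPiSubtypeProd (fun _ : PBond (F.P K) j => SU N) (· ∈ sV)).symm q) =
      (MeasurableEquiv.piEquivPiSubtypeProd (fun _ : PBond (F.P K) (j + 1) => SU N) (· ∈ sV')).symm
        (avgRestrOfRecord F N K j sV sV' q.1,
          fun c : {c : PBond (F.P K) (j + 1) // c ∉ sV'} =>
            (avOfRecord F N K j).avg
              ((MeasurableEquiv.piEquivPiSubtypeProd (fun _ : PBond (F.P K) j => SU N) (· ∈ sV)).symm q) c) := by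
  funext c
  by_cases hc : c ∈ sV'
  · rw [piEquivPiSubtypeProd_symm_apply_of_mem sV' _ hc]
    exact avOfRecord_glue_apply_of_mem F N K j hj hY hsV hsV' q ⟨c, hc⟩
  · rw [piEquivPiSubtypeProd_symm_apply_of_not_mem sV' _ hc]

/-- The skew intertwining read through the FORWARD coarse equivalence: splitting the averaged glued field at `sV'` gives the pair
(restricted averaging of the `sV`-part, remaining coarse variables). [cite: Balaban1988Convergent, (2.21) p.258, (3.1) p.264 (bookkeeping)] -/
theorem piEquivPiSubtypeProd_avOfRecord_glue (K j : ℕ) [DecidableEq (PBond (F.P K) j)] [DecidableEq (PBond (F.P K) (j + 1))]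
    (hj : j + 1 ≤ (F.P K).m + (F.P K).K)
    {Y : Set (Site (F.P K) 0)} (hY : ∀ s : Site (F.P K) j, toFine j s ∈ Y ↔ toFine (j + 1) (blockOf s) ∈ Y)
    {sV : Finset (PBond (F.P K) j)} (hsV : ∀ b : PBond (F.P K) j, b ∈ bondsIn j Y → b ∈ sV)
    {sV' : Finset (PBond (F.P K) (j + 1))} (hsV' : ∀ c : PBond (F.P K) (j + 1), c ∈ sV' → c ∈ bondsIn (j + 1) Y)
    (q : (↥sV → SU N) × ({b : PBond (F.P K) j // b ∉ sV} → SU N)) :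
    MeasurableEquiv.piEquivPiSubtypeProd (fun _ : PBond (F.P K) (j + 1) => SU N) (· ∈ sV')
        ((avOfRecord F N K j).avg ((MeasurableEquiv.piEquivPiSubtypeProd (fun _ : PBond (F.P K) j => SU N) (· ∈ sV)).symm q)) =
      (avgRestrOfRecord F N K j sV sV' q.1,
        fun c : {c : PBond (F.P K) (j + 1) // c ∉ sV'} =>
          (avOfRecord F N K j).avg
            ((MeasurableEquiv.piEquivPiSubtypeProd (fun _ : PBond (F.P K) j => SU N) (· ∈ sV)).symm q) c) := by
  have h := avOfRecord_glue_eq_glue F N K j hj hY hsV hsV' q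
  conv_lhs => rw [h]
  exact MeasurableEquiv.apply_symm_apply _ _

/-- The rest factor `q ↦ (c ↦ avg (glue q) c)` (`c ∉ sV'`) is measurable. [cite: Balaban1987RG1, (0.4) p.253 (kernel property of the tree's averaging, by name)] -/
theorem measurable_avOfRecord_glue_rest (K j : ℕ) [DecidableEq (PBond (F.P K) j)] (sV : Finset (PBond (F.P K) j))
    (sV' : Finset (PBond (F.P K) (j + 1))) :
    Measurable fun q : (↥sV → SU N) × ({b : PBond (F.P K) j // b ∉ sV} → SU N) =>
      fun c : {c : PBond (F.P K) (j + 1) // c ∉ sV'} =>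
        (avOfRecord F N K j).avg ((MeasurableEquiv.piEquivPiSubtypeProd (fun _ : PBond (F.P K) j => SU N) (· ∈ sV)).symm q) c :=
  measurable_pi_lambda _ fun c =>
    (measurable_pi_apply (c : PBond (F.P K) (j + 1))).comp
      ((avOfRecord_measurable F N K j).comp
        (MeasurableEquiv.piEquivPiSubtypeProd (fun _ : PBond (F.P K) j => SU N) (· ∈ sV)).symm.measurable)

/-- The whole skew map `q ↦ (q.1, avg_rest q)` is measurable. [cite: Balaban1987RG1, (0.4) p.253 (kernel property of the tree's averaging, by name)] -/
theorem measurable_avOfRecord_glue_skew (K j : ℕ) [DecidableEq (PBond (F.P K) j)] (sV : Finset (PBond (F.P K) j))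
    (sV' : Finset (PBond (F.P K) (j + 1))) :
    Measurable fun q : (↥sV → SU N) × ({b : PBond (F.P K) j // b ∉ sV} → SU N) =>
      (q.1, fun c : {c : PBond (F.P K) (j + 1) // c ∉ sV'} =>
        (avOfRecord F N K j).avg ((MeasurableEquiv.piEquivPiSubtypeProd (fun _ : PBond (F.P K) j => SU N) (· ∈ sV)).symm q) c) :=
  measurable_fst.prodMk (measurable_avOfRecord_glue_rest F N K j sV sV')

/-- THE ONE-VARIABLE LAW OF THE AVERAGING OF RECORD IN A PRIVATE COORDINATE IS ABSOLUTELY CONTINUOUS, for every configuration and every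
coarse bond, on `SU(N)` for every `N ≥ 1` (the tree's guarded fibre law `BlockAveragingEMLFibreLawSUN.emlFibreLaw_fin` through
`BlockAveragingEMLHaarAC.map_haar_avgFun_update_absolutelyContinuous_of_guard`). [cite: Balaban1987RG1, (0.4) p.253 (kernel property of the tree's averaging, by name)] -/
theorem map_haar_avOfRecord_update_centralBond_absolutelyContinuous (K j : ℕ) [DecidableEq (PBond (F.P K) j)]
    (hj : j + 1 ≤ (F.P K).m + (F.P K).K) (U : GaugeField (F.P K) j (SU N)) (c : PBond (F.P K) (j + 1)) :
    (HaarData.haar : Measure (SU N)).map (fun g => (avOfRecord F N K j).avg (update U (centralBond c) g) c) ≪ HaarData.haar :=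
  BlockAveragingEMLHaarAC.map_haar_avgFun_update_absolutelyContinuous_of_guard hj expMeanLogSU measurable_expMeanLogSU_E U c
    (BlockAveragingEMLHaarACSUN.haar_restrict_fibreGuard_map_absolutelyContinuous_of_fibreLaw
      BlockAveragingEMLFibreLawSUN.emlFibreLaw_fin U c)

/-- **★★ `hac_out` DISCHARGED: 11a's RESTRICTED AVERAGING PUSHES PRODUCT HAAR TO AN ABSOLUTELY CONTINUOUS LAW** (so `kernelRTOfRecord F N K j sV sV'`
IS a renormalization transformation of the `sV`-bond variables): for `sV ⊇ bondsIn j Y ⊇`… precisely `bondsIn j Y ⊆ sV` and `sV' ⊆ bondsIn (j+1) Y`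
over a saturated `Y`, `(Π_{sV} Haar).map (avgRestrOfRecord F N K j sV sV') ≪ Π_{sV'} Haar`.  Proof: the triangular push-forward theorem
`T4TriangularPushforward.map_pi_absolutelyContinuous_pi` in the private coordinates `c' ↦ β(c') ∈ sV` (§1 `centralBond_mem_bondsIn_iff`),
locality from `BlockAveragingHaarAC.isLocal_avgFun`, one-variable laws from the fibre law. [cite: Balaban1988Convergent, (2.21) p.258 (bookkeeping)] -/
theorem map_pi_avgRestrOfRecord_absolutelyContinuous (K j : ℕ) [DecidableEq (PBond (F.P K) j)]
    [DecidableEq (PBond (F.P K) (j + 1))] (hj : j + 1 ≤ (F.P K).m + (F.P K).K)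
    {Y : Set (Site (F.P K) 0)} (hY : ∀ s : Site (F.P K) j, toFine j s ∈ Y ↔ toFine (j + 1) (blockOf s) ∈ Y)
    {sV : Finset (PBond (F.P K) j)} (hsV : ∀ b : PBond (F.P K) j, b ∈ bondsIn j Y → b ∈ sV)
    {sV' : Finset (PBond (F.P K) (j + 1))} (hsV' : ∀ c : PBond (F.P K) (j + 1), c ∈ sV' → c ∈ bondsIn (j + 1) Y) :
    (Measure.pi fun _ : ↥sV => (HaarData.haar : Measure (SU N))).map (avgRestrOfRecord F N K j sV sV') ≪
      Measure.pi fun _ : ↥sV' => (HaarData.haar : Measure (SU N)) := by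
  have hmem : ∀ c : ↥sV', centralBond (c : PBond (F.P K) (j + 1)) ∈ sV := fun c =>
    hsV _ ((centralBond_mem_bondsIn_iff hj hY _).2 (hsV' _ c.2))
  let β : ↥sV' → ↥sV := fun c => ⟨centralBond (c : PBond (F.P K) (j + 1)), hmem c⟩
  have hβ : Injective β := fun c c' h =>
    Subtype.ext (centralBond_injective hj (congrArg Subtype.val h : (β c : PBond (F.P K) j) = β c'))
  have hloc : T4TriangularPushforward.IsLocal β (avgRestrOfRecord F N K j sV sV') := by
    intro y c g c' hc'
    show (avOfRecord F N K j).avg (updateFinset (fun _ => 1) sV (update y (β c) g)) c' =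
      (avOfRecord F N K j).avg (updateFinset (fun _ => 1) sV y) c'
    rw [updateFinset_update, avOfRecord_avg]
    exact isLocal_avgFun hj expMeanLogSU _ _ g _ fun h => hc' (Subtype.ext h)
  refine T4TriangularPushforward.map_pi_absolutelyContinuous_pi (HaarData.haar : Measure (SU N)) hloc hβ
    (measurable_avgRestrOfRecord K j sV sV') fun y c => ?_
  have hfun : (fun g => avgRestrOfRecord F N K j sV sV' (update y (β c) g) c) =
      fun g => (avOfRecord F N K j).avg (update (updateFinset (fun _ => 1) sV y) (centralBond (c : PBond (F.P K) (j + 1))) g) c := by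
    funext g
    show (avOfRecord F N K j).avg (updateFinset (fun _ => 1) sV (update y (β c) g)) c = _
    rw [updateFinset_update]
  rw [hfun]
  exact map_haar_avOfRecord_update_centralBond_absolutelyContinuous F N K j hj _ _

/-- **★★ `hac_in` DISCHARGED: THE SKEW MAP `(y, r) ↦ (y, avg_rest (y, r))` PUSHES PRODUCT HAAR TO AN ABSOLUTELY CONTINUOUS LAW.**
For `sV ⊆ bondsIn j Y` and `bondsIn (j+1) Y ⊆ sV'` over a saturated `Y` (so the private coordinate `β(c)` of a coarse bond `c ∉ sV'` is NOT
in `sV`, §1), `((Π_{sV} Haar) ⊗ (Π_{sVᶜ} Haar)).map (q ↦ (q.1, c ↦ avg (glue q) c)) ≪ (Π_{sV} Haar) ⊗ (Π_{sV'ᶜ} Haar)`.  Proof: resample the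
private coordinates `β(c)`, `c ∉ sV'`, of the off-`sV` part (`T4TriangularPushforward.measurePreserving_resample`, Haar a probability measure),
read the resampled glued field through locality (`apply_resample_eq`), and apply the parametric mixture engine §0 with the whole datum as
environment and its `sV`-part as the kept reading. [cite: Balaban1988Convergent, (2.21) p.258, (3.1) p.264 (bookkeeping)] -/
theorem map_prod_avOfRecord_glue_skew_absolutelyContinuous (K j : ℕ) [DecidableEq (PBond (F.P K) j)]
    [DecidableEq (PBond (F.P K) (j + 1))] (hj : j + 1 ≤ (F.P K).m + (F.P K).K)
    {Y : Set (Site (F.P K) 0)} (hY : ∀ s : Site (F.P K) j, toFine j s ∈ Y ↔ toFine (j + 1) (blockOf s) ∈ Y)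
    {sV : Finset (PBond (F.P K) j)} (hsV : ∀ b : PBond (F.P K) j, b ∈ sV → b ∈ bondsIn j Y)
    {sV' : Finset (PBond (F.P K) (j + 1))} (hsV' : ∀ c : PBond (F.P K) (j + 1), c ∈ bondsIn (j + 1) Y → c ∈ sV') :
    ((Measure.pi fun _ : ↥sV => (HaarData.haar : Measure (SU N))).prod
        (Measure.pi fun _ : {b : PBond (F.P K) j // b ∉ sV} => (HaarData.haar : Measure (SU N)))).map
        (fun q => (q.1, fun c : {c : PBond (F.P K) (j + 1) // c ∉ sV'} =>
          (avOfRecord F N K j).avg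
            ((MeasurableEquiv.piEquivPiSubtypeProd (fun _ : PBond (F.P K) j => SU N) (· ∈ sV)).symm q) c)) ≪
      (Measure.pi fun _ : ↥sV => (HaarData.haar : Measure (SU N))).prod
        (Measure.pi fun _ : {c : PBond (F.P K) (j + 1) // c ∉ sV'} => (HaarData.haar : Measure (SU N))) := by
  -- notation
  set μ : Measure (SU N) := HaarData.haar with hμ
  set eβ := (MeasurableEquiv.piEquivPiSubtypeProd (fun _ : PBond (F.P K) j => SU N) (· ∈ sV)).symm with heβ
  set S : (↥sV → SU N) × ({b : PBond (F.P K) j // b ∉ sV} → SU N) →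
      (↥sV → SU N) × ({c : PBond (F.P K) (j + 1) // c ∉ sV'} → SU N) :=
    fun q => (q.1, fun c => (avOfRecord F N K j).avg (eβ q) c) with hS
  have hSm : Measurable S := measurable_avOfRecord_glue_skew F N K j sV sV'
  -- private coordinates of the rest outputs: off `sV`
  have hnot : ∀ c : {c : PBond (F.P K) (j + 1) // c ∉ sV'}, centralBond (c : PBond (F.P K) (j + 1)) ∉ sV :=
    fun c h => c.2 (hsV' _ ((centralBond_mem_bondsIn_iff hj hY _).1 (hsV _ h)))
  let β : {c : PBond (F.P K) (j + 1) // c ∉ sV'} → {b : PBond (F.P K) j // b ∉ sV} :=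
    fun c => ⟨centralBond (c : PBond (F.P K) (j + 1)), hnot c⟩
  have hβ : Injective β := fun c c' h =>
    Subtype.ext (centralBond_injective hj (congrArg Subtype.val h : (β c : PBond (F.P K) j) = β c'))
  have hβ' : Injective (fun c => (β c : PBond (F.P K) j)) := fun c c' h => hβ (Subtype.ext h)
  -- locality of the rest outputs in the private coordinates, on the full field
  have hloc : T4TriangularPushforward.IsLocal (fun c => (β c : PBond (F.P K) j))
      (fun (U : GaugeField (F.P K) j (SU N)) (c : {c : PBond (F.P K) (j + 1) // c ∉ sV'}) => (avOfRecord F N K j).avg U c) := by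
    intro U c g c' hc'
    rw [avOfRecord_avg]
    exact isLocal_avgFun hj expMeanLogSU U _ g _ fun h => hc' (Subtype.ext h)
  -- the one-variable maps of the engine
  set f : {c : PBond (F.P K) (j + 1) // c ∉ sV'} →
      (↥sV → SU N) × ({b : PBond (F.P K) j // b ∉ sV} → SU N) → SU N → SU N :=
    fun c e g => (avOfRecord F N K j).avg (update (eβ e) (centralBond (c : PBond (F.P K) (j + 1))) g) c with hf
  have hfm : ∀ c, Measurable (uncurry (f c)) := fun c =>
    (measurable_pi_apply (c : PBond (F.P K) (j + 1))).comp ((avOfRecord_measurable F N K j).comp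
      (measurable_update'.comp ((eβ.measurable.comp measurable_fst).prodMk measurable_snd)))
  -- resampling of the off-`sV` part, as a measure-preserving map into the datum space, and reassociation
  have hres := T4TriangularPushforward.measurePreserving_resample μ hβ
  have hΨ : MeasurePreserving
      (Prod.map id (fun p : ({b : PBond (F.P K) j // b ∉ sV} → SU N) × ({c : PBond (F.P K) (j + 1) // c ∉ sV'} → SU N) =>
        extend β p.2 p.1))
      ((Measure.pi fun _ : ↥sV => μ).prod
        ((Measure.pi fun _ : {b : PBond (F.P K) j // b ∉ sV} => μ).prod
          (Measure.pi fun _ : {c : PBond (F.P K) (j + 1) // c ∉ sV'} => μ)))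
      ((Measure.pi fun _ : ↥sV => μ).prod (Measure.pi fun _ : {b : PBond (F.P K) j // b ∉ sV} => μ)) :=
    (MeasurePreserving.id _).prod hres
  have hA : MeasurePreserving MeasurableEquiv.prodAssoc
      (((Measure.pi fun _ : ↥sV => μ).prod (Measure.pi fun _ : {b : PBond (F.P K) j // b ∉ sV} => μ)).prod
        (Measure.pi fun _ : {c : PBond (F.P K) (j + 1) // c ∉ sV'} => μ))
      ((Measure.pi fun _ : ↥sV => μ).prod
        ((Measure.pi fun _ : {b : PBond (F.P K) j // b ∉ sV} => μ).prod
          (Measure.pi fun _ : {c : PBond (F.P K) (j + 1) // c ∉ sV'} => μ))) :=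
    ⟨MeasurableEquiv.prodAssoc.measurable, Measure.prodAssoc_prod⟩
  have hcomp := (hΨ.comp hA)
  -- the composite IS the engine's map
  have key : S ∘ (Prod.map id (fun p : ({b : PBond (F.P K) j // b ∉ sV} → SU N) ×
        ({c : PBond (F.P K) (j + 1) // c ∉ sV'} → SU N) => extend β p.2 p.1)) ∘ ⇑MeasurableEquiv.prodAssoc =
      fun p : ((↥sV → SU N) × ({b : PBond (F.P K) j // b ∉ sV} → SU N)) × ({c : PBond (F.P K) (j + 1) // c ∉ sV'} → SU N) =>
        (p.1.1, fun c => f c p.1 (p.2 c)) := by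
    funext p
    obtain ⟨⟨y, r⟩, g⟩ := p
    show S (y, extend β g r) = ((y, r).1, fun c => f c (y, r) (g c))
    simp only [hS, hf]
    refine Prod.ext rfl (funext fun c => ?_)
    show (avOfRecord F N K j).avg (eβ (y, extend β g r)) c = (avOfRecord F N K j).avg (update (eβ (y, r)) (centralBond c.1) (g c)) c
    rw [heβ, piEquivPiSubtypeProd_symm_extend sV hβ y r g]
    exact T4TriangularPushforward.apply_resample_eq hloc hβ' _ g c
  -- rewrite the law of the skew map through the resampling
  rw [← hcomp.map_eq, Measure.map_map hSm hcomp.measurable, key]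
  -- the engine, with the kept reading `π = Prod.fst`
  have hπ : ((Measure.pi fun _ : ↥sV => μ).prod (Measure.pi fun _ : {b : PBond (F.P K) j // b ∉ sV} => μ)).map Prod.fst =
      Measure.pi fun _ : ↥sV => μ := by
    rw [Measure.map_fst_prod, measure_univ, one_smul]
  have heng := map_prod_pi_absolutelyContinuous_param
    ((Measure.pi fun _ : ↥sV => μ).prod (Measure.pi fun _ : {b : PBond (F.P K) j // b ∉ sV} => μ)) μ
    measurable_fst f hfm (ae_of_all _ fun e c => ?_)
  · rw [hπ] at heng
    exact heng
  · exact map_haar_avOfRecord_update_centralBond_absolutelyContinuous F N K j hj (eβ e) c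

end OfRecord

/-! ## §3  At the bond sets of record `sV := (bondsIn j Y).toFinset`, `sV' := (bondsIn (j+1) Y).toFinset` -/

section AtRecordBondSets

variable (F : T4Family) (N : ℕ) [NeZero N]

/-- Membership in the finset of a finite bond set (`Set.Finite.mem_toFinset`, recorded in the shape 11a's `genDataOfRecord` uses).
[cite: Balaban1988Convergent, (2.21) p.258 (bookkeeping)] -/
theorem mem_toFinite_bondsIn_toFinset_iff {P : Params} {i : ℕ} (Y : Set (Site P 0)) (b : PBond P i) :
    b ∈ (Set.toFinite (bondsIn i Y)).toFinset ↔ b ∈ bondsIn i Y :=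
  Set.Finite.mem_toFinset _

/-- ★★ THE SKEW INTERTWINING at the bond sets of record of a saturated region. [cite: Balaban1988Convergent, (2.21) p.258, (3.1) p.264 (bookkeeping)] -/
theorem avOfRecord_glue_eq_glue_bondsIn (K j : ℕ) [DecidableEq (PBond (F.P K) j)] [DecidableEq (PBond (F.P K) (j + 1))]
    (hj : j + 1 ≤ (F.P K).m + (F.P K).K)
    {Y : Set (Site (F.P K) 0)} (hY : ∀ s : Site (F.P K) j, toFine j s ∈ Y ↔ toFine (j + 1) (blockOf s) ∈ Y)
    (q : (↥(Set.toFinite (bondsIn j Y)).toFinset → SU N) × ({b : PBond (F.P K) j // b ∉ (Set.toFinite (bondsIn j Y)).toFinset} → SU N)) :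
    (avOfRecord F N K j).avg
        ((MeasurableEquiv.piEquivPiSubtypeProd (fun _ : PBond (F.P K) j => SU N) (· ∈ (Set.toFinite (bondsIn j Y)).toFinset)).symm q) =
      (MeasurableEquiv.piEquivPiSubtypeProd (fun _ : PBond (F.P K) (j + 1) => SU N)
          (· ∈ (Set.toFinite (bondsIn (j + 1) Y)).toFinset)).symm
        (avgRestrOfRecord F N K j (Set.toFinite (bondsIn j Y)).toFinset (Set.toFinite (bondsIn (j + 1) Y)).toFinset q.1,
          fun c : {c : PBond (F.P K) (j + 1) // c ∉ (Set.toFinite (bondsIn (j + 1) Y)).toFinset} =>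
            (avOfRecord F N K j).avg
              ((MeasurableEquiv.piEquivPiSubtypeProd (fun _ : PBond (F.P K) j => SU N)
                (· ∈ (Set.toFinite (bondsIn j Y)).toFinset)).symm q) c) :=
  avOfRecord_glue_eq_glue F N K j hj hY (fun b hb => (mem_toFinite_bondsIn_toFinset_iff Y b).2 hb)
    (fun c hc => (mem_toFinite_bondsIn_toFinset_iff Y c).1 hc) q

/-- ★★ `hac_out` at the bond sets of record of a saturated region. [cite: Balaban1988Convergent, (2.21) p.258 (bookkeeping)] -/
theorem map_pi_avgRestrOfRecord_absolutelyContinuous_bondsIn (K j : ℕ) [DecidableEq (PBond (F.P K) j)]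
    [DecidableEq (PBond (F.P K) (j + 1))] (hj : j + 1 ≤ (F.P K).m + (F.P K).K)
    {Y : Set (Site (F.P K) 0)} (hY : ∀ s : Site (F.P K) j, toFine j s ∈ Y ↔ toFine (j + 1) (blockOf s) ∈ Y) :
    (Measure.pi fun _ : ↥(Set.toFinite (bondsIn j Y)).toFinset => (HaarData.haar : Measure (SU N))).map
        (avgRestrOfRecord F N K j (Set.toFinite (bondsIn j Y)).toFinset (Set.toFinite (bondsIn (j + 1) Y)).toFinset) ≪
      Measure.pi fun _ : ↥(Set.toFinite (bondsIn (j + 1) Y)).toFinset => (HaarData.haar : Measure (SU N)) :=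
  map_pi_avgRestrOfRecord_absolutelyContinuous F N K j hj hY (fun b hb => (mem_toFinite_bondsIn_toFinset_iff Y b).2 hb)
    (fun c hc => (mem_toFinite_bondsIn_toFinset_iff Y c).1 hc)

/-- ★★ `hac_in` at the bond sets of record of a saturated region. [cite: Balaban1988Convergent, (2.21) p.258, (3.1) p.264 (bookkeeping)] -/
theorem map_prod_avOfRecord_glue_skew_absolutelyContinuous_bondsIn (K j : ℕ) [DecidableEq (PBond (F.P K) j)]
    [DecidableEq (PBond (F.P K) (j + 1))] (hj : j + 1 ≤ (F.P K).m + (F.P K).K)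
    {Y : Set (Site (F.P K) 0)} (hY : ∀ s : Site (F.P K) j, toFine j s ∈ Y ↔ toFine (j + 1) (blockOf s) ∈ Y) :
    ((Measure.pi fun _ : ↥(Set.toFinite (bondsIn j Y)).toFinset => (HaarData.haar : Measure (SU N))).prod
        (Measure.pi fun _ : {b : PBond (F.P K) j // b ∉ (Set.toFinite (bondsIn j Y)).toFinset} =>
          (HaarData.haar : Measure (SU N)))).map
        (fun q => (q.1, fun c : {c : PBond (F.P K) (j + 1) // c ∉ (Set.toFinite (bondsIn (j + 1) Y)).toFinset} =>
          (avOfRecord F N K j).avg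
            ((MeasurableEquiv.piEquivPiSubtypeProd (fun _ : PBond (F.P K) j => SU N)
              (· ∈ (Set.toFinite (bondsIn j Y)).toFinset)).symm q) c)) ≪
      (Measure.pi fun _ : ↥(Set.toFinite (bondsIn j Y)).toFinset => (HaarData.haar : Measure (SU N))).prod
        (Measure.pi fun _ : {c : PBond (F.P K) (j + 1) // c ∉ (Set.toFinite (bondsIn (j + 1) Y)).toFinset} =>
          (HaarData.haar : Measure (SU N))) :=
  map_prod_avOfRecord_glue_skew_absolutelyContinuous F N K j hj hY (fun b hb => (mem_toFinite_bondsIn_toFinset_iff Y b).1 hb)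
    (fun c hc => (mem_toFinite_bondsIn_toFinset_iff Y c).2 hc)

end AtRecordBondSets

end Literature.MathematicalPhysics.QuantumFieldTheory.Balaban1983to89.Node00

end
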